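import Summits.BirchSwinnertonDyer.BirchSwinnertonDyer.Theorems.TwoAdicConverseTwoTorsionIsogenyPairs
import Summits.BirchSwinnertonDyer.BirchSwinnertonDyer.Theorems.TwoAdicConverseGoodOrdinaryTwistFamily
import Summits.BirchSwinnertonDyer.BirchSwinnertonDyer.Theorems.TwoAdicConverseLambdaHalfDefs
import HarnessLib

/-!
# Route `TwoAdicConverse` (rung S3), item 19218: the (β) stratum keyed to the crux 19556's per-curve predicate
# `LambdaHalfAtTwo` — ONE `λ`-half per `ℤ/2`-linked pair, at the Prop-5.14 member or at the Prop-5.13 member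

Cell `bsd-2adic`, seat `bsd-2adic-conv-1` (GEN 19).  THEOREMS ONLY; `--supports stmt-BirchSwinnertonDyer-19218`.
HONEST FRAMING: BSD is not proved by any of this; 19218 and 19556 stay OPEN; every binder below is either the
item-19167 PRINT constant `OrdConversePublishedInputsAtTwo` (modularity ∧ Kato 17.4 (1)(2)@2 ∧ Greenberg Thm. 4.1,
displayed by name) or the research predicate `LambdaHalfAtTwo` (= item 19556 at one curve).  PARTITION (D-0054):
none — RANK axis (S3) × stratum (β) at good-ordinary `2`.

Companion of `TwoAdicConverseTwoTorsionIsogenyPairs` (the pair (`W`, `W'`) linked by `C • W` normal form,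
`C' • W' = (C • W).twoIsogenyCodomain` is an isogeny; «neither» is eliminated along it).  Here the converse is
read through conv-1's per-curve bridge `analyticRank_eq_zero_of_selmerCorank_eq_zero_of_lam_le` (p424885:
PUB + `λ_an ≤ λ_alg` at `W` ⟹ `corank_{ℤ₂} Sel_{2^∞}(W) = 0 ⇒ r_an(W) = 0`):

* §1 `rankZeroTwoConverseAt_of_pub_of_lambdaHalfAtTwo` — PUB + `LambdaHalfAtTwo W` ⟹ the converse at `W`;
  `rankZeroTwoConverseAt_both_of_lambdaHalfAtTwo_left/right` — on a `ℤ/2`-linked pair, the `λ`-half at EITHER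
  member gives the converse at BOTH (the `λ`-half is itself an isogeny invariant, conv-1 GEN 3
  `lambdaHalfAtTwo_iff_of_isIsogenous`, but that is not even needed: the converse transports by
  `rankZeroTwoConverseAt_iff_of_twoTorsionPair`).
* §2 **The (β) piece of 19218 from PUB + the `λ`-half on the two Greenberg configurations**
  (`goodOrd_twoTorsion_rankZero_of_pub_of_lambdaHalf_mixed_ramifiedOdd`): `LambdaHalfAtTwo` for every non-CM
  good-ordinary curve carrying a Prop-5.14 point (M) and for every one carrying a Prop-5.13 point (R) suffices —
  exactly the per-configuration obligations of the crux 19556 on (β); the pen's idea `gv-mixed-descent-two`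
  (Cruxes/OrdLambdaHalfAtTwo/Ideas) addresses (M) with EQUALITY `λ = Σ(N) − 2`; (R) (86 census classes) is the
  configuration where Greenberg's Prop. 5.14 is silent at every member of the pair.
* §3 19218 BY NAME (`goodOrdinaryRankZeroTwoConverse_of_kolyvaginAtTwo_of_lambdaHalf_configurations`): the
  Kolyvagin cone on the habitat (24622 V1′, 24623 V2♭, 24405, PRINT) + PUB 19167 + `λ`-half on (M) + `λ`-half on
  (R) + the two `E[2]`-irreducible slivers (γ₁), (γ₂) of conv-1 GEN 18.

References: Greenberg LNM 1716 §5 Props. 5.13–5.14 [GreenbergLNM1716]; Greenberg–Vatsal, Invent. Math. 142 (2000)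
p. 4 [GreenbergVatsal2000]; Kato, Astérisque 295 Thm. 17.4 [Kato2004Asterisque]; W. Zhang 2014 Thm. 1.1 [WZhang2014].
-/

set_option linter.dupNamespace false  -- `BirchSwinnertonDyer.BirchSwinnertonDyer` is the sub's path (D-0017)
set_option autoImplicit false

noncomputable section

open scoped Classical
open CongruenceSubgroup WeierstrassCurve Literature Literature.NumberTheory.EllipticCurves
  Literature.NumberTheory.EllipticCurves.ModularForms
  Literature.NumberTheory.EllipticCurves.Rank1Residual
  Literature.NumberTheory.EllipticCurves.Greenberg1999
  Summit.BirchSwinnertonDyer.BirchSwinnertonDyer.Theses.TwoAdicConverse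
  Summit.BirchSwinnertonDyer.BirchSwinnertonDyer.Theorems.TwoAdicKolyvaginRankZero
  Summit.BirchSwinnertonDyer.BirchSwinnertonDyer.Theorems.TwoAdicTwistConverse

namespace Summit.BirchSwinnertonDyer.BirchSwinnertonDyer.Theorems.TwoAdicOffHabitat

/-! ## §1 PUB + the `λ`-half at one curve ⟹ the converse there; on a pair, at both members -/

section One

variable {W W' : WeierstrassCurve ℚ} [W.IsElliptic] [W.IsGloballyMinimal] [W'.IsElliptic] [W'.IsGloballyMinimal]
  {C C' : VariableChange ℚ}

variable (W) in
/-- **PUB (item 19167) + `LambdaHalfAtTwo W` ⟹ the rank-`0` `2`-converse at `W`** (good ordinary at `2`): conv-1's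
bridge `analyticRank_eq_zero_of_selmerCorank_eq_zero_of_lam_le` with the leaf's ordinary guard discharged by
`GoodOrd W 2`. [cite: GreenbergLNM1716, Thm. 4.1 (p. 102)] [cite: GreenbergVatsal2000, p. 4 (after Thm. (1.2))]
[cite: Kato2004Asterisque, Thm. 17.4 (1)(2) (p. 273)] -/
theorem rankZeroTwoConverseAt_of_pub_of_lambdaHalfAtTwo (hP : Literature.Uncategorized.OrdConversePublishedInputsAtTwo)
    (hgo : GoodOrd W 2) (hL : LambdaHalfAtTwo W) : W.selmerCorank 2 = 0 → W.analyticRank = 0 := by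
  obtain ⟨hmod, h17, hGr⟩ := hP
  exact analyticRank_eq_zero_of_selmerCorank_eq_zero_of_lam_le W hmod (fun f => h17 W f) hGr hgo
    (fun κ γ hκ hγ hγ' _ f hf D => hL κ γ hκ hγ hγ' hgo f hf D)

omit [W'.IsGloballyMinimal] in
/-- **On a `ℤ/2`-linked pair, the `λ`-half at `W` gives the converse at BOTH members.**
[cite: GreenbergVatsal2000, p. 4 (after Thm. (1.2))] [cite: Knapp1993, Thm. 11.67] -/
theorem rankZeroTwoConverseAt_both_of_lambdaHalfAtTwo_left
    (hP : Literature.Uncategorized.OrdConversePublishedInputsAtTwo) (hgo : GoodOrd W 2) [(C • W).IsTwoTorsionNF]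
    (hlink : C' • W' = (C • W).twoIsogenyCodomain) (hL : LambdaHalfAtTwo W) :
    (W.selmerCorank 2 = 0 → W.analyticRank = 0) ∧ (W'.selmerCorank 2 = 0 → W'.analyticRank = 0) :=
  ⟨rankZeroTwoConverseAt_of_pub_of_lambdaHalfAtTwo W hP hgo hL,
    (rankZeroTwoConverseAt_iff_of_twoTorsionPair hlink).mp
      (rankZeroTwoConverseAt_of_pub_of_lambdaHalfAtTwo W hP hgo hL)⟩

/-- **On a `ℤ/2`-linked pair, the `λ`-half at `W'` gives the converse at BOTH members.**
[cite: GreenbergVatsal2000, p. 4 (after Thm. (1.2))] [cite: Knapp1993, Thm. 11.67] -/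
theorem rankZeroTwoConverseAt_both_of_lambdaHalfAtTwo_right
    (hP : Literature.Uncategorized.OrdConversePublishedInputsAtTwo) (hgo : GoodOrd W 2) [(C • W).IsTwoTorsionNF]
    (hlink : C' • W' = (C • W).twoIsogenyCodomain) (hL' : LambdaHalfAtTwo W') :
    (W.selmerCorank 2 = 0 → W.analyticRank = 0) ∧ (W'.selmerCorank 2 = 0 → W'.analyticRank = 0) :=
  have hgo' : GoodOrd W' 2 := (goodOrd_two_iff_of_twoTorsionPair hlink).mp hgo
  ⟨(rankZeroTwoConverseAt_iff_of_twoTorsionPair hlink).mpr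
      (rankZeroTwoConverseAt_of_pub_of_lambdaHalfAtTwo W' hP hgo' hL'),
    rankZeroTwoConverseAt_of_pub_of_lambdaHalfAtTwo W' hP hgo' hL'⟩

end One

/-! ## §2 The (β) piece of 19218 from PUB + the `λ`-half on the two Greenberg configurations -/

/-- **Stratum (β) from PUB + `λ`-half on (M) mixed-point curves + `λ`-half on (R) ramified-odd-point curves.**
The «neither» configuration needs no `λ`-input of its own (`goodOrd_twoTorsion_rankZero_of_mixed_of_ramifiedOdd`).
[cite: GreenbergLNM1716, Props. 5.13–5.14 (chunks p0168–p0170)] [cite: GreenbergVatsal2000, p. 4 (after Thm. (1.2))] -/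
theorem goodOrd_twoTorsion_rankZero_of_pub_of_lambdaHalf_mixed_ramifiedOdd
    (hP : Literature.Uncategorized.OrdConversePublishedInputsAtTwo)
    (hΛM : ∀ (W : WeierstrassCurve ℚ) [W.IsElliptic] [W.IsGloballyMinimal], ¬ W.HasCM → GoodOrd W 2 →
      (∃ x : ℚ, HasRationalTwoTorsionX W x ∧
        ((TwoTorsionRamifiedAtTwo x ∧ ¬ TwoTorsionOdd W x) ∨ (TwoTorsionOdd W x ∧ ¬ TwoTorsionRamifiedAtTwo x))) →
      LambdaHalfAtTwo W)
    (hΛR : ∀ (W : WeierstrassCurve ℚ) [W.IsElliptic] [W.IsGloballyMinimal], ¬ W.HasCM → GoodOrd W 2 →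
      (∃ x : ℚ, HasRationalTwoTorsionX W x ∧ TwoTorsionRamifiedAtTwo x ∧ TwoTorsionOdd W x) →
      LambdaHalfAtTwo W) :
    ∀ (W : WeierstrassCurve ℚ) [W.IsElliptic] [W.IsGloballyMinimal], ¬ W.HasCM → GoodOrd W 2 →
      (∃ P : W.toAffine.Point, P ≠ 0 ∧ 2 • P = 0) → W.selmerCorank 2 = 0 → W.analyticRank = 0 :=
  goodOrd_twoTorsion_rankZero_of_mixed_of_ramifiedOdd
    (fun W _ _ hCM hgo hx => rankZeroTwoConverseAt_of_pub_of_lambdaHalfAtTwo W hP hgo (hΛM W hCM hgo hx))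
    (fun W _ _ hCM hgo hx => rankZeroTwoConverseAt_of_pub_of_lambdaHalfAtTwo W hP hgo (hΛR W hCM hgo hx))

/-- **The off-big-image rank-`0` complement at a good ordinary `2`** from PUB + `λ`-half on (M) + `λ`-half on (R)
+ the two `E[2]`-irreducible slivers (γ₁) (`C₃` image) and (γ₂) (`ρ̄₂` onto, `-Δ ∈ ℚ^{×2}`).
[cite: GreenbergLNM1716, Props. 5.13–5.14 (chunks p0168–p0170)] [cite: DokchitserDokchitserMathZ2012, Theorem (1)–(3) and Lemma] -/
theorem goodOrd_offBigImage_rankZero_of_pub_of_lambdaHalf_configurations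
    (hP : Literature.Uncategorized.OrdConversePublishedInputsAtTwo)
    (hΛM : ∀ (W : WeierstrassCurve ℚ) [W.IsElliptic] [W.IsGloballyMinimal], ¬ W.HasCM → GoodOrd W 2 →
      (∃ x : ℚ, HasRationalTwoTorsionX W x ∧
        ((TwoTorsionRamifiedAtTwo x ∧ ¬ TwoTorsionOdd W x) ∨ (TwoTorsionOdd W x ∧ ¬ TwoTorsionRamifiedAtTwo x))) →
      LambdaHalfAtTwo W)
    (hΛR : ∀ (W : WeierstrassCurve ℚ) [W.IsElliptic] [W.IsGloballyMinimal], ¬ W.HasCM → GoodOrd W 2 →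
      (∃ x : ℚ, HasRationalTwoTorsionX W x ∧ TwoTorsionRamifiedAtTwo x ∧ TwoTorsionOdd W x) →
      LambdaHalfAtTwo W)
    (hγ₁ : ∀ (W : WeierstrassCurve ℚ) [W.IsElliptic] [W.IsGloballyMinimal], ¬ W.HasCM → GoodOrd W 2 →
      (∀ P : W.toAffine.Point, 2 • P = 0 → P = 0) → IsSquare W.Δ →
      W.selmerCorank 2 = 0 → W.analyticRank = 0)
    (hγ₂ : ∀ (W : WeierstrassCurve ℚ) [W.IsElliptic] [W.IsGloballyMinimal], ¬ W.HasCM → GoodOrd W 2 →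
      W.HasSurjectiveModNGaloisRep 2 → IsSquare (-W.Δ) →
      W.selmerCorank 2 = 0 → W.analyticRank = 0) :
    ∀ (W : WeierstrassCurve ℚ) [W.IsElliptic] [W.IsGloballyMinimal], ¬ W.HasCM → GoodOrd W 2 →
      ¬ (∀ m : ℕ, W.HasSurjectiveModNGaloisRep (2 ^ m : ℕ)) →
      W.selmerCorank 2 = 0 → W.analyticRank = 0 :=
  goodOrd_offBigImage_rankZero_of_three_strata
    (goodOrd_twoTorsion_rankZero_of_pub_of_lambdaHalf_mixed_ramifiedOdd hP hΛM hΛR) hγ₁ hγ₂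

/-! ## §3 Item 19218 BY NAME -/

/-- **Item 19218 `GoodOrdinaryRankZeroTwoConverse` BY NAME** from: the Kolyvagin cone on the habitat (V1′ 24622,
V2♭ 24623, 24405, PRINT; conv-1 GEN 17 p607060), PUB 19167, the crux 19556's predicate `LambdaHalfAtTwo` on the
(M) mixed and (R) ramified-odd configurations of stratum (β), and the slivers (γ₁), (γ₂).  The route decl, fully
qualified; conditional on every displayed binder. [cite: WZhang2014, Thm. 1.1 (shape at p ≥ 5)]
[cite: GreenbergVatsal2000, p. 4 (after Thm. (1.2))] [cite: GreenbergLNM1716, Props. 5.13–5.14 (chunks p0168–p0170)] -/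
theorem goodOrdinaryRankZeroTwoConverse_of_kolyvaginAtTwo_of_lambdaHalf_configurations
    (hV1 : KolyvaginNonvanishingAtTwoFrame) (hV2 : KolyvaginCorankLowerBoundAtTwo)
    (hT : NoTwoTorsionOverK)
    (hmod : exists_isNewformOf)
    (hBFH : bumpFriedbergHoffstein_exists_heegnerField_split_twist_simpleZero)
    (hpar : ∀ (V : WeierstrassCurve ℚ) [V.IsElliptic], p_parity V 2)
    (hGZK : rank_eq_analyticRank_of_analyticRank_le_one)
    (hE : WeierstrassCurve.hasEntireLFunction_rat)
    (hGZ : ∀ (V : WeierstrassCurve ℚ) (N : ℕ) [NeZero N] (K : Type) [Field K] [NumberField K],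
      analyticRankEK_eq_one_iff_heegner_nonTorsion V N K)
    (hrec : ∀ (N : ℕ) [NeZero N] (V : WeierstrassCurve ℚ) (K : Type) [Field K] [NumberField K],
      heegnerPointOfConductor_one_galoisConj N V K)
    (hP : Literature.Uncategorized.OrdConversePublishedInputsAtTwo)
    (hΛM : ∀ (W : WeierstrassCurve ℚ) [W.IsElliptic] [W.IsGloballyMinimal], ¬ W.HasCM → GoodOrd W 2 →
      (∃ x : ℚ, HasRationalTwoTorsionX W x ∧
        ((TwoTorsionRamifiedAtTwo x ∧ ¬ TwoTorsionOdd W x) ∨ (TwoTorsionOdd W x ∧ ¬ TwoTorsionRamifiedAtTwo x))) →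
      LambdaHalfAtTwo W)
    (hΛR : ∀ (W : WeierstrassCurve ℚ) [W.IsElliptic] [W.IsGloballyMinimal], ¬ W.HasCM → GoodOrd W 2 →
      (∃ x : ℚ, HasRationalTwoTorsionX W x ∧ TwoTorsionRamifiedAtTwo x ∧ TwoTorsionOdd W x) →
      LambdaHalfAtTwo W)
    (hγ₁ : ∀ (W : WeierstrassCurve ℚ) [W.IsElliptic] [W.IsGloballyMinimal], ¬ W.HasCM → GoodOrd W 2 →
      (∀ P : W.toAffine.Point, 2 • P = 0 → P = 0) → IsSquare W.Δ →
      W.selmerCorank 2 = 0 → W.analyticRank = 0)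
    (hγ₂ : ∀ (W : WeierstrassCurve ℚ) [W.IsElliptic] [W.IsGloballyMinimal], ¬ W.HasCM → GoodOrd W 2 →
      W.HasSurjectiveModNGaloisRep 2 → IsSquare (-W.Δ) →
      W.selmerCorank 2 = 0 → W.analyticRank = 0) :
    Summit.BirchSwinnertonDyer.BirchSwinnertonDyer.Theses.TwoAdicConverse.GoodOrdinaryRankZeroTwoConverse :=
  goodOrdinaryRankZeroTwoConverse_of_kolyvaginAtTwo_of_three_strata hV1 hV2 hT hmod hBFH hpar hGZK hE hGZ
    hrec (goodOrd_twoTorsion_rankZero_of_pub_of_lambdaHalf_mixed_ramifiedOdd hP hΛM hΛR) hγ₁ hγ₂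

end Summit.BirchSwinnertonDyer.BirchSwinnertonDyer.Theorems.TwoAdicOffHabitat

end
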